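import Literature.Computability.Complexity.PaulPippengerSzemerediTrotter1983ClaimsComplete
import HarnessLib

/-!
# The four-alternation protocol: light claims for all blocks, heavy data branch by branch (PPST 1983, §3)

Literature / complexity toolkit, twelfth brick of the inline formalization of
Paul–Pippenger–Szemerédi–Trotter 1983 (`PaulPippengerSzemerediTrotter1983.lean`, fact
`PaulEtAl1983_NTIME_not_subset_DTIME`; roadmap Layer 4, mathematical core, part 5). In the `Σ₄`
simulation the existential player cannot afford to claim the heavy data (contents of touched
height blocks) of EVERY time block — that would be the whole computation. He claims (`∃ y₁`) the
LIGHT data of every block (control, heights, extreme heights: `O(log T)` bits each), a set `J` of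
blocks (a segregator) and the heavy data of the blocks of `J` only; for every block `j` (`∀ y₂`) he
then supplies (`∃ y₃`) heavy data for a set `A ∋ j` of blocks closed under "last toucher outside
`J`" (the ancestors of `j` in `G − J`, few of them when `J` is a segregator), and every local check
(`∀ y₄`) of `…Claims.lean` is run on the blocks of `A`, reading heavy data from `y₁` on `J` and from
`y₃` on `A ∖ J`. This file proves that this BRANCH-BY-BRANCH checking is still sound and complete:

* `TM2Blocks.merge Γ J A H` — the family of claims seen in the branch: light data and `J`-heavy
  data from the global claims `Γ`, heavy data from `H` on `A ∖ J`; its light fields, `loC`, `hiC`,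
  `cutC` are those of `Γ` (`merge_l`, …, `loC_merge`, …);
* `Closed b Γ J A` (every last toucher, outside `J`, of a height block claimed touched by a block of
  `A` is in `A`), `BranchOK c₀ b N Γ J j A H` (the checks of branch `j`), `LightOK`, `MnMxOK`,
  `HeavyOK` (truth of the light / extreme-height / heavy fields of a global claim);
* **`branch_sound`** — inside a passing branch `j`, given the truth of the light data up to `j`,
  of the extreme heights before `j` and of the `J`-heavy data before `j`, every block of `A` below
  `N` is fully correct for the merged family (inner induction in time order;
  `frag_correct_of_condDep'`, `correct_step`);
* **`protocol_sound`** — if block `0`'s light data are initial and every branch `j ≤ N` passes with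
  SOME `A`, `H`, then all light data are true, all extreme heights below `N` are true, and the heavy
  data claimed for the blocks of `J` below `N` are true (outer induction in time order: the light
  data of `v` come from branch `v - 1`, its extreme heights and `J`-heavy data from branch `v`);
* **`protocol_complete`** — the true light data, ANY `J`, the true `J`-heavy data, and in branch `j`
  the closure `branchSet` of `{j}` under last touchers outside `J` with the true heavy data, pass.

No named fact is introduced (definitions with bodies and theorems only).

## References

* W. J. Paul, N. Pippenger, E. Szemerédi, W. T. Trotter, *On determinism versus non-determinism
  and related problems*, FOCS 1983, 429–438, §3 (the `Σ₄` simulation) [PaulEtAl1983].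
* R. Santhanam, *On separators, segregators and time versus space*, CCC 2001, §2 (p. 4:
  segregators; the ancestors in `G − J` are what is recomputed) [Santhanam2001].
-/

namespace Literature.Computability.Complexity

open Turing Function Relation

namespace TM2Blocks

variable {tm : FinTM2}

/-! ### The merged family of a branch -/

/-- Heavy data for some blocks: start and end contents above the cut. [folklore] -/
abbrev Heavy (tm : FinTM2) : Type := (∀ k, List (tm.Γ k)) × (∀ k, List (tm.Γ k))

/-- **The claims seen in a branch**: light data and `J`-heavy data from the global claims `Γ`,
heavy data from the branch's `H` on `A ∖ J`. [cite: PaulEtAl1983, §3] -/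
noncomputable def merge (Γ : ℕ → BlockClaim tm) (J A : Finset ℕ) (H : ℕ → Heavy tm) :
    ℕ → BlockClaim tm := fun v =>
  if v ∈ A ∧ v ∉ J then { Γ v with frag := (H v).1, efrag := (H v).2 } else Γ v

section MergeLemmas

variable (Γ : ℕ → BlockClaim tm) (J A : Finset ℕ) (H : ℕ → Heavy tm) (v : ℕ) (b : ℕ) (k : tm.K)

/-- The label is global. [folklore] -/
@[simp] theorem merge_l : (merge Γ J A H v).l = (Γ v).l := by
  unfold merge; split_ifs <;> rfl
/-- The state is global. [folklore] -/
@[simp] theorem merge_var : (merge Γ J A H v).var = (Γ v).var := by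
  unfold merge; split_ifs <;> rfl
/-- The heights are global. [folklore] -/
@[simp] theorem merge_ht : (merge Γ J A H v).ht = (Γ v).ht := by
  unfold merge; split_ifs <;> rfl
/-- The minimal heights are global. [folklore] -/
@[simp] theorem merge_mn : (merge Γ J A H v).mn = (Γ v).mn := by
  unfold merge; split_ifs <;> rfl
/-- The maximal heights are global. [folklore] -/
@[simp] theorem merge_mx : (merge Γ J A H v).mx = (Γ v).mx := by
  unfold merge; split_ifs <;> rfl
/-- `loC` is global. [folklore] -/
@[simp] theorem loC_merge : (merge Γ J A H v).loC b k = (Γ v).loC b k := by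
  unfold BlockClaim.loC; rw [merge_mn]
/-- `hiC` is global. [folklore] -/
@[simp] theorem hiC_merge : (merge Γ J A H v).hiC b k = (Γ v).hiC b k := by
  unfold BlockClaim.hiC; rw [merge_mx]
/-- `cutC` is global. [folklore] -/
@[simp] theorem cutC_merge : (merge Γ J A H v).cutC b k = (Γ v).cutC b k := by
  unfold BlockClaim.cutC; rw [loC_merge]
/-- On `J` the heavy data are global. [folklore] -/
theorem merge_of_mem_J (hv : v ∈ J) : merge Γ J A H v = Γ v := by
  unfold merge; rw [if_neg (fun h => h.2 hv)]
/-- Outside `A` the claims are global. [folklore] -/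
theorem merge_of_not_mem_A (hv : v ∉ A) : merge Γ J A H v = Γ v := by
  unfold merge; rw [if_neg (fun h => hv h.1)]

end MergeLemmas

/-! ### Branches and truth predicates -/

/-- **Closure of a branch set**: every last toucher (computed from the claimed `lo`/`hi`), outside
`J`, of a height block claimed touched by a block of `A` lies in `A`. [cite: Santhanam2001, §2 (p. 4: ancestors in G − J)] -/
def Closed (b : ℕ) (Γ : ℕ → BlockClaim tm) (J A : Finset ℕ) : Prop :=
  ∀ u ∈ A, ∀ k B p, (Γ u).loC b k ≤ B → B ≤ (Γ u).hiC b k →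
    lastToucher (fun m => (Γ m).loC b k) (fun m => (Γ m).hiC b k) u B = some p → p ∉ J → p ∈ A

/-- **The checks of branch `j`**: `j ∈ A`, `A` closed, the local re-simulation of every block of
`A` below `N`, the dependency checks of every block of `A` up to `N`, and the initial contents if
`0 ∈ A` — all on the merged family. [cite: PaulEtAl1983, §3] -/
def BranchOK (c₀ : tm.Cfg) (b N : ℕ) (Γ : ℕ → BlockClaim tm) (J : Finset ℕ) (j : ℕ) (A : Finset ℕ)
    (H : ℕ → Heavy tm) : Prop :=
  j ∈ A ∧ Closed b Γ J A ∧
    (∀ u ∈ A, u < N → CondSim b (merge Γ J A H) u) ∧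
    (∀ u ∈ A, u ≤ N → CondDep c₀ b (merge Γ J A H) u) ∧
    (0 ∈ A → ∀ k, (merge Γ J A H 0).frag k = above ((Γ 0).cutC b k) (c₀.stk k))

/-- Block `0`'s light data are initial. [folklore] -/
def LightInit (c₀ : tm.Cfg) (Γ : ℕ → BlockClaim tm) : Prop :=
  (Γ 0).l = c₀.l ∧ (Γ 0).var = c₀.var ∧ ∀ k, (Γ 0).ht k = (c₀.stk k).length

/-- The light data of claim `v` are true. [folklore] -/
def LightOK (c₀ : tm.Cfg) (b : ℕ) (Γ : ℕ → BlockClaim tm) (v : ℕ) : Prop :=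
  (Γ v).l = (run tm c₀ (v * b)).l ∧ (Γ v).var = (run tm c₀ (v * b)).var ∧
    ∀ k, (Γ v).ht k = ((run tm c₀ (v * b)).stk k).length

/-- The extreme heights of claim `v` are true. [folklore] -/
def MnMxOK (c₀ : tm.Cfg) (b : ℕ) (Γ : ℕ → BlockClaim tm) (v : ℕ) : Prop :=
  (∀ k, (Γ v).mn k = minH tm c₀ b k v) ∧ ∀ k, (Γ v).mx k = maxH tm c₀ b k v

/-- The heavy data of claim `v` are true. [folklore] -/
def HeavyOK (c₀ : tm.Cfg) (b : ℕ) (Γ : ℕ → BlockClaim tm) (v : ℕ) : Prop :=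
  (∀ k, (Γ v).frag k = above (lo tm c₀ b k v * blockβ tm b) ((run tm c₀ (v * b)).stk k)) ∧
    ∀ k, (Γ v).efrag k = above (lo tm c₀ b k v * blockβ tm b) ((run tm c₀ ((v + 1) * b)).stk k)

variable {c₀ : tm.Cfg} {b N : ℕ} {Γ : ℕ → BlockClaim tm} {J : Finset ℕ}

/-- True extreme heights give the true `lo`. [folklore] -/
theorem MnMxOK.loC_eq {v : ℕ} (h : MnMxOK c₀ b Γ v) (k : tm.K) : (Γ v).loC b k = lo tm c₀ b k v := by
  unfold BlockClaim.loC lo; rw [h.1 k]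

/-- True extreme heights give the true `hi`. [folklore] -/
theorem MnMxOK.hiC_eq {v : ℕ} (h : MnMxOK c₀ b Γ v) (k : tm.K) : (Γ v).hiC b k = hi tm c₀ b k v := by
  unfold BlockClaim.hiC hi; rw [h.2 k]

/-! ### Soundness of one branch -/

/-- **Soundness inside a branch.** Let branch `j` pass with `A`, `H`. If the light data are
true up to `j`, the extreme heights are true before `j`, and the `J`-heavy data are true before
`j`, then every block `u ∈ A` with `u ≤ j`, `u < N` is fully correct for the merged family, and
the merged family has the true light data at `u + 1`. Inner induction on `u`: the start contents
of `u` are validated by (C2) against the end contents of the last touchers, which lie in `J`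
(true by hypothesis) or in `A` (true by induction) — `frag_correct_of_condDep'` —, then (C1) makes
`u` fully correct (`correct_step`). [cite: PaulEtAl1983, §3] -/
theorem branch_sound {j : ℕ} {A : Finset ℕ} {H : ℕ → Heavy tm} (hbr : BranchOK c₀ b N Γ J j A H)
    (hL : ∀ u, u ≤ j → LightOK c₀ b Γ u) (hM : ∀ u, u < j → MnMxOK c₀ b Γ u)
    (hJ : ∀ u, u < j → u ∈ J → HeavyOK c₀ b Γ u) :
    ∀ u, u ∈ A → u ≤ j → u < N →
      FullyCorrect c₀ b (merge Γ J A H) u ∧ LightOK c₀ b (merge Γ J A H) (u + 1) := by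
  obtain ⟨-, hcl, hsim, hdep, hinit⟩ := hbr
  set M := merge Γ J A H with hMdef
  intro u
  induction u using Nat.strong_induction_on with
  | _ u ih =>
    intro huA huj huN
    -- light data of `u` (global) are true
    have hlight : LightOK c₀ b M u := by
      obtain ⟨h1, h2, h3⟩ := hL u huj
      exact ⟨by simpa [M] using h1, by simpa [M] using h2, fun k => by simpa [M] using h3 k⟩
    have hs := hsim u huA huN
    -- start contents of `u`
    have hfrag : ∀ k, (M u).frag k = above ((M u).cutC b k) ((run tm c₀ (u * b)).stk k) := by
      rcases Nat.eq_zero_or_pos u with rfl | hpos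
      · intro k
        simpa [M, run] using hinit huA k
      · refine frag_correct_of_condDep' (fun m hm => ⟨fun k => ?_, fun k => ?_⟩) ?_ hlight.2.2 hs.1
          hs.2.2.2.2.2.2 (hdep u huA huN.le)
        · simpa [M] using (hM m (by omega)).loC_eq k
        · simpa [M] using (hM m (by omega)).hiC_eq k
        · intro k B i hlo hhi hlt
          obtain ⟨hiu, hti, -⟩ := lastToucher_spec hlt
          -- `i` is a last toucher of a claimed-touched block: in `J` or in `A`
          have hlt' : lastToucher (fun m => (Γ m).loC b k) (fun m => (Γ m).hiC b k) u B = some i := by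
            rw [← hlt]
            refine lastToucher_claims_eq' (c₀ := c₀) (Γ := Γ) (fun m hm => ⟨fun k => ?_, fun k => ?_⟩) k B
            · exact (hM m (by omega)).loC_eq k
            · exact (hM m (by omega)).hiC_eq k
          have hloΓ : (Γ u).loC b k ≤ B := by simpa [M] using hlo
          have hhiΓ : B ≤ (Γ u).hiC b k := by simpa [M] using hhi
          by_cases hiA : i ∈ A
          · -- in the branch: induction
            have hfi := (ih i hiu hiA (by omega) (by omega)).1
            exact ⟨hfi.cutC_eq k, hfi.2.2.2 k⟩
          · -- outside the branch: a block of `J`, whose heavy data are global and true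
            have hiJ : i ∈ J := by
              by_contra hiJ
              exact hiA (hcl u huA k B i hloΓ hhiΓ hlt' hiJ)
            have hMi : M i = Γ i := merge_of_not_mem_A Γ J A H i hiA
            have hheavy := hJ i (by omega) hiJ
            refine ⟨?_, ?_⟩
            · rw [hMi]
              unfold BlockClaim.cutC
              rw [(hM i (by omega)).loC_eq k]
            · rw [hMi]; exact hheavy.2 k
    have hcorr : Correct c₀ b M u := ⟨hlight.1, hlight.2.1, hlight.2.2, hfrag⟩
    obtain ⟨hfull, hl, hv, hht⟩ := correct_step hcorr hs
    exact ⟨hfull, hl, hv, hht⟩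

/-! ### Soundness of the protocol -/

/-- **Soundness of the branch-by-branch checks.** If block `0`'s light data are initial and every
branch `j ≤ N` passes with some closed set `A ∋ j` and some heavy data on it, then every claim
`v ≤ N` has the true light data, every claim `v < N` the true extreme heights, and every claim
`v < N` with `v ∈ J` the true heavy data. Outer induction on `v`: the light data of `v` are
produced by branch `v - 1` (`branch_sound` at `u = v - 1`), its extreme heights and `J`-heavy data
by branch `v` (`branch_sound` at `u = v`). No property of `J` is used. [cite: PaulEtAl1983, §3 (correctness of the Σ₄ simulation)] -/
theorem protocol_sound (hinit : LightInit c₀ Γ)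
    (hbr : ∀ j, j ≤ N → ∃ (A : Finset ℕ) (H : ℕ → Heavy tm), BranchOK c₀ b N Γ J j A H) :
    ∀ v, v ≤ N → LightOK c₀ b Γ v ∧ (v < N → MnMxOK c₀ b Γ v ∧ (v ∈ J → HeavyOK c₀ b Γ v)) := by
  intro v
  induction v using Nat.strong_induction_on with
  | _ v ih =>
    intro hvN
    -- light data of `v`
    have hlight : LightOK c₀ b Γ v := by
      rcases Nat.eq_zero_or_pos v with rfl | hpos
      · obtain ⟨h1, h2, h3⟩ := hinit
        exact ⟨by simpa [run] using h1, by simpa [run] using h2, fun k => by simpa [run] using h3 k⟩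
      · obtain ⟨A, H, hb⟩ := hbr (v - 1) (by omega)
        have hres := branch_sound (j := v - 1) hb
          (fun u hu => (ih u (by omega) (by omega)).1)
          (fun u hu => ((ih u (by omega) (by omega)).2 (by omega)).1)
          (fun u hu huJ => ((ih u (by omega) (by omega)).2 (by omega)).2 huJ)
          (v - 1) hb.1 le_rfl (by omega)
        obtain ⟨h1, h2, h3⟩ := hres.2
        rw [show v - 1 + 1 = v by omega] at h1 h2 h3
        exact ⟨by simpa using h1, by simpa using h2, fun k => by simpa using h3 k⟩
    refine ⟨hlight, fun hvN' => ?_⟩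
    -- extreme heights and `J`-heavy data of `v`: branch `v`
    obtain ⟨A, H, hb⟩ := hbr v hvN
    have hres := branch_sound (j := v) hb
      (fun u hu => by
        rcases Nat.lt_or_ge u v with huv | huv
        · exact (ih u huv (by omega)).1
        · have : u = v := by omega
          subst this; exact hlight)
      (fun u hu => ((ih u hu (by omega)).2 (by omega)).1)
      (fun u hu huJ => ((ih u hu (by omega)).2 (by omega)).2 huJ)
      v hb.1 le_rfl hvN'
    have hfull := hres.1
    have hmm : MnMxOK c₀ b Γ v :=
      ⟨fun k => by simpa using hfull.2.1 k, fun k => by simpa using hfull.2.2.1 k⟩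
    refine ⟨hmm, fun hvJ => ?_⟩
    have hMv : merge Γ J A H v = Γ v := merge_of_mem_J Γ J A H v hvJ
    refine ⟨fun k => ?_, fun k => ?_⟩
    · have h1 := hfull.1.2.2.2 k
      rw [hfull.cutC_eq k, hMv] at h1
      exact h1
    · have h1 := hfull.2.2.2 k
      rw [hMv] at h1
      exact h1

/-! ### Completeness -/

/-- The record update with its own heavy fields is the identity. [folklore] -/
theorem update_self_heavy (C : BlockClaim tm) : { C with frag := C.frag, efrag := C.efrag } = C := by
  cases C; rfl

/-- With the true claims and the true heavy data the merged family is the true claims. [folklore] -/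
theorem merge_trueClaims (c₀ : tm.Cfg) (b : ℕ) (J A : Finset ℕ) :
    merge (trueClaims tm c₀ b) J A (fun v => ((trueClaims tm c₀ b v).frag, (trueClaims tm c₀ b v).efrag)) =
      trueClaims tm c₀ b := by
  funext v
  unfold merge
  split_ifs
  · exact update_self_heavy _
  · rfl

/-- The last-toucher edges of the true run, over all stacks, as a relation whose SOURCE avoids `J`.
[folklore] -/
def truePredRel (c₀ : tm.Cfg) (b : ℕ) (J : Finset ℕ) (p u : ℕ) : Prop :=
  p ∉ J ∧ ∃ k B, lo tm c₀ b k u ≤ B ∧ B ≤ hi tm c₀ b k u ∧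
    lastToucher (lo tm c₀ b k) (hi tm c₀ b k) u B = some p

open scoped Classical in
/-- **The branch set of `j`**: `j` together with the blocks reaching `j` along last-toucher edges
whose sources avoid `J` (the ancestors of `j` in `G − J`, plus for `j ∈ J` their entry points).
[cite: Santhanam2001, §2 (p. 4)] -/
noncomputable def branchSet (c₀ : tm.Cfg) (b : ℕ) (J : Finset ℕ) (j : ℕ) : Finset ℕ :=
  (Finset.range (j + 1)).filter fun u => u = j ∨ TransGen (truePredRel c₀ b J) u j

/-- Sources of last-toucher edges are earlier. [folklore] -/
theorem truePredRel_lt {c₀ : tm.Cfg} {b : ℕ} {J : Finset ℕ} {p u : ℕ} (h : truePredRel c₀ b J p u) :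
    p < u := by
  obtain ⟨-, k, B, -, -, hlt⟩ := h
  exact (lastToucher_spec hlt).1

/-- Ancestors along the relation are earlier. [folklore] -/
theorem transGen_truePredRel_lt {c₀ : tm.Cfg} {b : ℕ} {J : Finset ℕ} {p u : ℕ}
    (h : TransGen (truePredRel c₀ b J) p u) : p < u := by
  induction h with
  | single h => exact truePredRel_lt h
  | tail _ h ih => exact lt_trans ih (truePredRel_lt h)

/-- `j` is in its branch set. [folklore] -/
theorem mem_branchSet_self (c₀ : tm.Cfg) (b : ℕ) (J : Finset ℕ) (j : ℕ) : j ∈ branchSet c₀ b J j := by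
  simp [branchSet]

/-- The branch set is closed for the true claims. [folklore] -/
theorem closed_branchSet (c₀ : tm.Cfg) (b : ℕ) (J : Finset ℕ) (j : ℕ) :
    Closed b (trueClaims tm c₀ b) J (branchSet c₀ b J j) := by
  intro u hu k B p hlo hhi hlt hpJ
  simp only [loC_trueClaims, hiC_trueClaims] at hlo hhi hlt
  have hlt' : lastToucher (lo tm c₀ b k) (hi tm c₀ b k) u B = some p := hlt
  have hrel : truePredRel c₀ b J p u := ⟨hpJ, k, B, hlo, hhi, hlt'⟩
  simp only [branchSet, Finset.mem_filter, Finset.mem_range] at hu ⊢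
  obtain ⟨huj, hu⟩ := hu
  have hpu := truePredRel_lt hrel
  refine ⟨by omega, Or.inr ?_⟩
  rcases hu with rfl | hu
  · exact TransGen.single hrel
  · exact TransGen.head hrel hu

/-- **Completeness of the branch-by-branch checks**: the true light data, any `J`, the true
`J`-heavy data, and in branch `j` the branch set of `j` with the true heavy data, pass.
[cite: PaulEtAl1983, §3] -/
theorem protocol_complete (c₀ : tm.Cfg) (b N : ℕ) (J : Finset ℕ) (j : ℕ) :
    BranchOK c₀ b N (trueClaims tm c₀ b) J j (branchSet c₀ b J j)
      (fun v => ((trueClaims tm c₀ b v).frag, (trueClaims tm c₀ b v).efrag)) := by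
  refine ⟨mem_branchSet_self c₀ b J j, closed_branchSet c₀ b J j, fun u _ _ => ?_, fun u _ _ => ?_,
    fun _ k => ?_⟩
  · rw [merge_trueClaims]; exact condSim_trueClaims c₀ b u
  · rw [merge_trueClaims]; exact condDep_trueClaims c₀ b u
  · rw [merge_trueClaims]
    exact (condInit_trueClaims (tm := tm) c₀ b).2.2.2 k

/-- The true claims have initial light data. [folklore] -/
theorem lightInit_trueClaims (c₀ : tm.Cfg) (b : ℕ) : LightInit c₀ (trueClaims tm c₀ b) :=
  ⟨(condInit_trueClaims (tm := tm) c₀ b).1, (condInit_trueClaims (tm := tm) c₀ b).2.1,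
    (condInit_trueClaims (tm := tm) c₀ b).2.2.1⟩

end TM2Blocks

end Literature.Computability.Complexity
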